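import Literature.NumberTheory.Automorphic.UnitaryGroupRestrictedProduct
import Mathlib.Topology.Algebra.Valued.ValuationTopology
import Mathlib.Topology.Connected.TotallyDisconnected
import HarnessLib

/-!
# Finite-adelic matrix groups are totally disconnected

Topic `NumberTheory/Automorphic`, namespaces `Literature.NumberTheory.Automorphic` (generic §1–§2) and
`Literature.NumberTheory.Automorphic.UnitaryGroup` (§3).  THEOREMS ONLY (no `instance` — consumers bind with `haveI`).

* §1 `totallyDisconnectedSpace_of_continuous_injective` — a space that injects continuously into a totally disconnected space
  is totally disconnected; `Valued.totallySeparatedSpace'` — a valued division ring is totally separated (the balls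
  `{x | v (x - a) < r}` are CLOPEN, Mathlib `Valued.isClopen_ball`; [BourbakiTG] III §2 / [PlatonovRapinchuk1994] §1.1–1.2
  «les corps localement compacts non archimédiens sont totalement discontinus»);
* §2 `totallyDisconnectedSpace_finiteAdeleRing` (the finite adèle ring `𝔸_{E,f} = Πʳ_v E_v` injects continuously into
  `Π_v E_v`), `totallyDisconnectedSpace_matrix`, `totallyDisconnectedSpace_units`, hence `GL_N(𝔸_{E,f})`;
* §3 **`UnitaryGroup.totallyDisconnectedSpace_finAdelic`**: `U(J)(𝔸_{F,f}) ≤ GL_N(𝔸_{E,f})` (★ `UnitaryGroup.finAdelic`) is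
  totally disconnected — the binder `[TotallyDisconnectedSpace G]` of the tree's ★ `CompactOpenSubgroupTrace(Monotone)`
  (Chevalley/Platonov–Rapinchuk trace lemmas, [Deligne1971TravauxShimura] Prop. 1.15) at `G = U(H)(𝔸_f)`.

## References
* [PlatonovRapinchuk1994] V. Platonov, A. Rapinchuk, *Algebraic Groups and Number Theory* (1994), §1.1–1.2, §3.3, §5.1
  (topology of local fields and of adelic groups: totally disconnected, locally compact).
* [Deligne1971TravauxShimura] P. Deligne, *Travaux de Shimura* (1971), Prop. 1.15 p. 132.
-/

set_option autoImplicit false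

open NumberField IsDedekindDomain Topology

namespace Literature.NumberTheory.Automorphic

/-! ## §1 Generic transfer and valued division rings -/

section Generic

/-- **A continuous injection into a totally disconnected space has totally disconnected source** (images of preconnected
sets are preconnected, hence subsingletons, hence so are the sets themselves). [cite: PlatonovRapinchuk1994, §3.3] -/
theorem totallyDisconnectedSpace_of_continuous_injective {X Y : Type*} [TopologicalSpace X] [TopologicalSpace Y]
    [TotallyDisconnectedSpace Y] {f : X → Y} (hf : Continuous f) (hinj : Function.Injective f) :
    TotallyDisconnectedSpace X := by
  refine ⟨fun s _ hs => ?_⟩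
  exact Set.subsingleton_of_image hinj s ((hs.image f hf.continuousOn).subsingleton)

/-- **A valued division ring is totally separated**: for `x ≠ y` the ball `{z | v (z - x) < v (y - x)}` is clopen
(Mathlib `Valued.isClopen_ball`, translated), contains `x` and misses `y`.  (Nonarchimedean local fields are totally
disconnected, [PlatonovRapinchuk1994] §1.1–1.2.) [cite: PlatonovRapinchuk1994, §1.1] -/
theorem Valued.totallySeparatedSpace' {K : Type*} [DivisionRing K] {Γ₀ : Type*}
    [LinearOrderedCommGroupWithZero Γ₀] [_i : Valued K Γ₀] : TotallySeparatedSpace K := by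
  refine totallySeparatedSpace_iff_exists_isClopen.mpr (fun x y hxy => ?_)
  -- the clopen ball of radius `v (y - x)` around `x`
  let r := (Valued.v (R := K)).restrict (y - x)
  have hr : r ≠ 0 := by
    simp only [r, ne_eq, map_eq_zero, sub_eq_zero]
    exact fun h => hxy h.symm
  let U : Set K := (fun z => z - x) ⁻¹' {w | (Valued.v (R := K)).restrict w < r}
  have hcont : Continuous fun z : K => z - x := continuous_id.sub continuous_const
  have hU : IsClopen U := (Valued.isClopen_ball K r).preimage hcont
  refine ⟨U, hU, ?_, ?_⟩
  · show (Valued.v (R := K)).restrict (x - x) < r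
    rw [sub_self, map_zero]
    exact zero_lt_iff.mpr hr
  · show ¬ (Valued.v (R := K)).restrict (y - x) < r
    exact lt_irrefl _

/-- A valued division ring is totally disconnected. [cite: PlatonovRapinchuk1994, §1.1] -/
theorem Valued.totallyDisconnectedSpace' {K : Type*} [DivisionRing K] {Γ₀ : Type*}
    [LinearOrderedCommGroupWithZero Γ₀] [Valued K Γ₀] : TotallyDisconnectedSpace K := by
  haveI := Valued.totallySeparatedSpace' (K := K)
  infer_instance

/-- Matrices over a totally disconnected space are totally disconnected (product topology; the matrix groups of
[PlatonovRapinchuk1994] §3.3 inherit the topology of `M_N(𝔸) = 𝔸^{N²}`). [cite: PlatonovRapinchuk1994, §3.3] -/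
theorem totallyDisconnectedSpace_matrix {m n A : Type*} [TopologicalSpace A] [TotallyDisconnectedSpace A] :
    TotallyDisconnectedSpace (Matrix m n A) :=
  inferInstanceAs (TotallyDisconnectedSpace (m → n → A))

/-- The units of a topological monoid with totally disconnected carrier are totally disconnected (their topology is
induced along `Mˣ ↪ M × Mᵐᵒᵖ`; for `GL_N` this is the topology of [PlatonovRapinchuk1994] §3.3, `g ↦ (g, g⁻¹)`).
[cite: PlatonovRapinchuk1994, §3.3] -/
theorem totallyDisconnectedSpace_units {M : Type*} [Monoid M] [TopologicalSpace M] [TotallyDisconnectedSpace M] :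
    TotallyDisconnectedSpace Mˣ := by
  haveI : TotallyDisconnectedSpace Mᵐᵒᵖ :=
    totallyDisconnectedSpace_of_continuous_injective MulOpposite.continuous_unop MulOpposite.unop_injective
  exact totallyDisconnectedSpace_of_continuous_injective Units.continuous_embedProduct
    (Units.embedProduct_injective M)

end Generic

/-! ## §2 The finite adèle ring and `GL_N` over it -/

section Adele

variable (E : Type*) [Field E] [NumberField E]

/-- **The finite adèle ring `𝔸_{E,f}` is totally disconnected**: it injects continuously (`RestrictedProduct.continuous_coe`)
into the product `Π_v E_v` of the completions, each a valued field, hence totally disconnected.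
[cite: PlatonovRapinchuk1994, §1.2 and §5.1] -/
theorem totallyDisconnectedSpace_finiteAdeleRing : TotallyDisconnectedSpace (FiniteAdeleRing (𝓞 E) E) := by
  haveI : ∀ v : HeightOneSpectrum (𝓞 E), TotallyDisconnectedSpace (v.adicCompletion E) :=
    fun v => Valued.totallyDisconnectedSpace'
  haveI : TotallyDisconnectedSpace
      (RestrictedProduct (fun v : HeightOneSpectrum (𝓞 E) => v.adicCompletion E)
        (fun v => (v.adicCompletionIntegers E : Set (v.adicCompletion E))) Filter.cofinite) :=
    totallyDisconnectedSpace_of_continuous_injective RestrictedProduct.continuous_coe DFunLike.coe_injective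
  exact inferInstanceAs <| TotallyDisconnectedSpace
    (RestrictedProduct (fun v : HeightOneSpectrum (𝓞 E) => v.adicCompletion E)
      (fun v => (v.adicCompletionIntegers E : Set (v.adicCompletion E))) Filter.cofinite)

/-- **`GL_N(𝔸_{E,f})` is totally disconnected** (units of the totally disconnected matrix ring).
[cite: PlatonovRapinchuk1994, §5.1] -/
theorem totallyDisconnectedSpace_GL_finiteAdeleRing (N : ℕ) :
    TotallyDisconnectedSpace (GL (Fin N) (FiniteAdeleRing (𝓞 E) E)) := by
  haveI := totallyDisconnectedSpace_finiteAdeleRing E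
  haveI : TotallyDisconnectedSpace (Matrix (Fin N) (Fin N) (FiniteAdeleRing (𝓞 E) E)) :=
    totallyDisconnectedSpace_matrix
  exact totallyDisconnectedSpace_units

end Adele

/-! ## §3 The finite-adelic points of a unitary group -/

namespace UnitaryGroup

variable (F E : Type) [Field F] [NumberField F] [Field E] [NumberField E] [Algebra F E]
variable (c : E ≃ₐ[F] E) (N : ℕ) (J : Matrix (Fin N) (Fin N) E)

omit [NumberField F] in
/-- **`U(J)(𝔸_{F,f})` is totally disconnected** (a subgroup of `GL_N(𝔸_{E,f})`) — the `[TotallyDisconnectedSpace G]` binder of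
the tree's trace lemmas `CompactOpenSubgroupTrace.exists_isOpen_isCompact_subgroup_comap_eq` /
`CompactOpenSubgroupTraceMonotone.exists_monotone_isOpen_isCompact_subgroup_comap_eq` at `G = U(H)(𝔸_{F,f})`
([Deligne1971TravauxShimura] Prop. 1.15). [cite: PlatonovRapinchuk1994, §5.1] [cite: Deligne1971TravauxShimura, Prop. 1.15 p. 132] -/
theorem totallyDisconnectedSpace_finAdelic : TotallyDisconnectedSpace ↥(finAdelic F E c N J) := by
  haveI := totallyDisconnectedSpace_GL_finiteAdeleRing E N
  infer_instance

end UnitaryGroup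

end Literature.NumberTheory.Automorphic
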